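import Literature.Probability.RandomPlanarGeometry.HexParafermionProofs
import Literature.Barriers.CriticalPhenomena.ParafermionicHalfCauchyRiemann

/-!
# Peeling a door: the first-step renewal of exit masses of self-avoiding walks

Helper file for the crux `NoFoldBound` (stmt-CriticalPhenomena-8296) of the route `SAWDevelopingMap`
(sub-problem `SAWScalingLimit` of `CriticalPhenomena`), programme FLAT / PEELED LP of the lead seats
c9–c10 (evidence `PEELED-LP.md`, `FLAT-FINITE.md`, `FLAT-LEAN-DESIGN.md` on the item): the flat instance
of the returning-loop bound (`SourceLoopBound`, `stub_slitLoopFifth`) is certified by a finite linear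
programme whose unknowns are the EXIT MASSES

  `g(D, {p,q}, z) = Σ_{γ ⊂ D : {p,q} → z} x^{ℓ(γ)}`     (`p ∉ D ∋ q` a door, `z` a mid-edge)

of the sub-domains `D = S ∖ K` of one strip `S`, linked by three exact operations on walks. This file
proves the first and most used one, the FIRST-STEP RENEWAL ("peeling the door vertex `q`"): a walk
from the door `{p,q}` visits `q` first and then, unless it stops at once, steps to a neighbour
`t ≠ p` of `q` and continues as a walk of `D ∖ {q}` from the new door `{q,t}`; the correspondence is
a bijection, the length drops by one. Hence, for every target mid-edge `z` not containing `q`,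

  `Σ_{γ ⊂ D : {p,q} → z} x^ℓ = x · Σ_{t ∼ q, t ≠ p} Σ_{δ ⊂ D∖q : {q,t} → z} x^ℓ`     (`sum_pow_length_peel`)

and for an immediate exit `z = {q,y}`, `y ∉ D`, `y ≠ p`, the sum is `x` (`sum_pow_length_exit`).
Self-avoiding walks between mid-edges are those of Duminil-Copin–Smirnov (`HexMidEdgeSAW`,
`HexParafermion.lean`); the neighbour finset is `HexGreen.nbrs` (`ParafermionicHalfCauchyRiemann.lean`).

## Contents (namespace `Summit.CriticalPhenomena.SAWScalingLimit.Theorems.SAWDevelopingMapNoFoldBound.Peel`)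
* `verts_ne_nil`, `exists_cons`, `exists_cons_cons` — a walk from a door `{p,q}` to `z ∌ q` reads
  `q :: t :: l`, `t ∼ q`, `t ≠ p`;
* `exists_tail` / `exists_glue` — cutting off / gluing back the door vertex (walks of `D.erase q`
  from `{q,t}`), `headD_mem` — the second vertex;
* **`sum_pow_length_peel`** (a `Finset.sum_bij'` on each fibre of the second vertex),
  **`sum_pow_length_exit`**, `sum_pow_length_door_self`.
-/

noncomputable section

open scoped BigOperators Classical
open Literature.Probability.LatticeModels Literature.Probability.RandomPlanarGeometry.SAW
open Literature.Barriers.CriticalPhenomena.HexGreen (nbrs mem_nbrs_iff)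

namespace Summit.CriticalPhenomena.SAWScalingLimit.Theorems.SAWDevelopingMapNoFoldBound.Peel

variable {D : Finset HexVertex} {p q : HexVertex} {z : Sym2 HexVertex}

/-! ### Walks from a door -/

/-- The only walk from a boundary door back to itself is trivial, so its mass is `1 = x⁰`
(restated for exit masses). -/
theorem sum_pow_length_door_self (hp : p ∉ D) (hq : q ∈ D) (hpq : hexGraph.Adj p q) (x : ℝ) :
    ∑ γ : HexMidEdgeSAW D s(p, q) s(p, q), x ^ γ.length = 1 := by
  have hb : s(p, q) ∈ hexDomainBoundary D :=
    ⟨(SimpleGraph.mem_edgeSet hexGraph).2 hpq, p, q, rfl, hq, hp⟩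
  have hmid : s(p, q) ∈ hexDomainMidEdges D :=
    ⟨(SimpleGraph.mem_edgeSet hexGraph).2 hpq, q, Sym2.mem_mk_right _ _, hq⟩
  have huniq : ∀ γ : HexMidEdgeSAW D s(p, q) s(p, q), γ = HexMidEdgeSAW.trivial hmid := fun γ =>
    HexMidEdgeSAW.ext (HexMidEdgeSAW.verts_eq_nil_of_mem_boundary hb γ)
  have : (Finset.univ : Finset (HexMidEdgeSAW D s(p, q) s(p, q))) = {HexMidEdgeSAW.trivial hmid} := by
    ext γ; simp [huniq γ]
  rw [this, Finset.sum_singleton]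
  simp

/-- A walk from the door `{p,q}` (`p ∉ D`) to a mid-edge `z ≠ {p,q}` is nontrivial. -/
theorem verts_ne_nil (hz : z ≠ s(p, q)) (γ : HexMidEdgeSAW D s(p, q) z) : γ.verts ≠ [] :=
  fun h => hz (γ.eq_of_nil h).symm

/-- A walk from the door `{p,q}` (`p ∉ D`) to `z ≠ {p,q}` starts at `q`. -/
theorem exists_cons (hp : p ∉ D) (hz : z ≠ s(p, q)) (γ : HexMidEdgeSAW D s(p, q) z) :
    ∃ l, γ.verts = q :: l := by
  obtain ⟨y, l, hyl⟩ := List.exists_cons_of_ne_nil (verts_ne_nil hz γ)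
  have hy : y ∈ s(p, q) := γ.head_mem y (by simp [hyl])
  rcases Sym2.mem_iff.1 hy with rfl | rfl
  · exact absurd (γ.subset y (by simp [hyl])) hp
  · exact ⟨l, hyl⟩

/-- If moreover `q ∉ z`, the walk makes a first step `q → t` with `t ∼ q`, `t ≠ p`, `t ∈ D`. -/
theorem exists_cons_cons (hp : p ∉ D) (hqz : q ∉ z) (γ : HexMidEdgeSAW D s(p, q) z) :
    ∃ t l, γ.verts = q :: t :: l ∧ hexGraph.Adj q t ∧ t ≠ p ∧ t ∈ D := by
  have hz : z ≠ s(p, q) := fun h => hqz (h ▸ Sym2.mem_mk_right _ _)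
  obtain ⟨l, hl⟩ := exists_cons hp hz γ
  have hlne : l ≠ [] := by
    rintro rfl
    have hlast : q ∈ z := γ.getLast_mem q (by simp [hl])
    exact hqz hlast
  obtain ⟨t, l', rfl⟩ := List.exists_cons_of_ne_nil hlne
  have hch := γ.isChain
  rw [hl] at hch
  have hqt : hexGraph.Adj q t := (List.isChain_cons_cons.1 hch).1
  have htD : t ∈ D := γ.subset t (by simp [hl])
  exact ⟨t, l', hl, hqt, fun h => hp (h ▸ htD), htD⟩

/-! ### Cutting off the door vertex, gluing it back -/

/-- **Cutting.** The tail of a walk `q :: t :: l` from the door `{p,q}` to `z ∌ q` is (the vertex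
list of) a walk of `D ∖ {q}` from the door `{q,t}` to `z`; here `t` is read off as
`γ.verts.tail.headD p`. -/
theorem exists_tail (hp : p ∉ D) (hqz : q ∉ z) (γ : HexMidEdgeSAW D s(p, q) z) {t : HexVertex}
    (ht : γ.verts.tail.headD p = t) :
    ∃ δ : HexMidEdgeSAW (D.erase q) s(q, t) z, δ.verts = γ.verts.tail := by
  obtain ⟨t', l, hl, hqt, -, htD⟩ := exists_cons_cons hp hqz γ
  have ht' : t' = t := by rw [hl] at ht; simpa using ht
  subst ht'
  have hnd := γ.nodup
  rw [hl, List.nodup_cons] at hnd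
  have hch := γ.isChain
  rw [hl] at hch
  have hed := γ.edges_nodup (by rw [hl]; exact List.cons_ne_nil _ _)
  rw [hl, edges_cons_cons] at hed
  refine ⟨⟨t' :: l, ?_, hnd.2, (List.isChain_cons_cons.1 hch).2, ?_, ?_,
    fun h => absurd h (List.cons_ne_nil _ _), fun _ => (List.nodup_cons.1 hed).2, ?_⟩, by rw [hl]; rfl⟩
  · intro v hv
    exact Finset.mem_erase.2 ⟨fun h => hnd.1 (h ▸ hv),
      γ.subset v (by rw [hl]; exact List.mem_cons_of_mem q hv)⟩
  · intro v hv
    simp only [List.head?_cons, Option.some.injEq] at hv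
    exact hv ▸ Sym2.mem_mk_right _ _
  · intro v hv
    exact γ.getLast_mem v (by rw [hl, List.getLast?_cons_cons]; exact hv)
  · exact ⟨(SimpleGraph.mem_edgeSet hexGraph).2 hqt, t', Sym2.mem_mk_right _ _,
      Finset.mem_erase.2 ⟨hqt.ne.symm, htD⟩⟩

/-- A walk of `D ∖ {q}` from the door `{q,t}` to `z ∌ q` starts at `t`. -/
theorem exists_cons_of_erase {t : HexVertex} (hqz : q ∉ z) (δ : HexMidEdgeSAW (D.erase q) s(q, t) z) :
    ∃ l, δ.verts = t :: l :=
  exists_cons (D := D.erase q) (Finset.notMem_erase q D)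
    (fun h : z = s(q, t) => hqz (by rw [h]; exact Sym2.mem_mk_left q t)) δ

/-- **Gluing.** Prefixing the door vertex `q` to a walk of `D ∖ {q}` from the door `{q,t}`
(`t ∼ q`, `t ≠ p`) to `z ∌ q` gives (the vertex list of) a walk of `D` from the door `{p,q}` to `z`. -/
theorem exists_glue (hp : p ∉ D) (hq : q ∈ D) (hpq : hexGraph.Adj p q) (hqz : q ∉ z) {t : HexVertex}
    (hqt : hexGraph.Adj q t) (htp : t ≠ p) (δ : HexMidEdgeSAW (D.erase q) s(q, t) z) :
    ∃ γ : HexMidEdgeSAW D s(p, q) z, γ.verts = q :: δ.verts := by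
  obtain ⟨l, hl⟩ := exists_cons_of_erase hqz δ
  have hed := δ.edges_nodup (by rw [hl]; exact List.cons_ne_nil _ _)
  rw [hl] at hed
  refine ⟨⟨q :: δ.verts, ?_, ?_, ?_, ?_, ?_, fun h => absurd h (List.cons_ne_nil _ _), fun _ => ?_,
    ⟨(SimpleGraph.mem_edgeSet hexGraph).2 hpq, q, Sym2.mem_mk_right _ _, hq⟩⟩, rfl⟩
  · intro v hv
    rcases List.mem_cons.1 hv with rfl | hv
    · exact hq
    · exact Finset.mem_of_mem_erase (δ.subset v hv)
  · rw [List.nodup_cons]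
    exact ⟨fun h => Finset.notMem_erase q D (δ.subset q h), δ.nodup⟩
  · have h := δ.isChain
    rw [hl] at h ⊢
    exact List.isChain_cons_cons.2 ⟨hqt, h⟩
  · intro v hv
    simp only [List.head?_cons, Option.some.injEq] at hv
    exact hv ▸ Sym2.mem_mk_right _ _
  · intro v hv
    refine δ.getLast_mem v ?_
    rw [hl] at hv ⊢
    rwa [List.getLast?_cons_cons] at hv
  · -- `{p,q}` is not an edge of the glued tail: every later edge has both ends in `D ∖ q`, or is `z`
    rw [hl, edges_cons_cons, List.cons_append, List.nodup_cons]
    refine ⟨fun hm => ?_, hed⟩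
    rcases List.mem_append.1 hm with hm | hm
    · rcases List.mem_cons.1 hm with hm | hm
      · have : p ∈ s(q, t) := hm ▸ Sym2.mem_mk_left p q
        rcases Sym2.mem_iff.1 this with h | h
        · exact hp (h ▸ hq)
        · exact htp h.symm
      · have hq' : q ∈ t :: l := forall_mem_of_mem_edges _ _ hm q (Sym2.mem_mk_right p q)
        exact Finset.notMem_erase q D (δ.subset q (hl ▸ hq'))
    · rw [List.mem_singleton] at hm
      exact hqz (hm ▸ Sym2.mem_mk_right p q)

/-- The second vertex `γ.verts.tail.headD p` of a walk from the door `{p,q}` to `z ∌ q` is a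
neighbour `≠ p` of `q`. -/
theorem headD_mem (hp : p ∉ D) (hqz : q ∉ z) (γ : HexMidEdgeSAW D s(p, q) z) :
    γ.verts.tail.headD p ∈ (nbrs q).erase p := by
  obtain ⟨t, l, hl, hqt, htp, -⟩ := exists_cons_cons hp hqz γ
  rw [hl, List.tail_cons, List.headD_cons, Finset.mem_erase, mem_nbrs_iff]
  exact ⟨htp, hqt⟩

/-! ### The renewal identities -/

/-- **First-step renewal (peeling the door vertex).** For a door `{p,q}` of `D` (`p ∉ D ∋ q`,
`p ∼ q`) and a target mid-edge `z` not containing `q`,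
`Σ_{γ ⊂ D : {p,q} → z} x^{ℓ(γ)} = x · Σ_{t ∼ q, t ≠ p} Σ_{δ ⊂ D ∖ q : {q,t} → z} x^{ℓ(δ)}`
(the summand for `t ∉ D` is an empty sum): cut / glue is a bijection on each fibre of the second
vertex, and the length drops by one. -/
theorem sum_pow_length_peel : ∀ {D : Finset HexVertex} {p q : HexVertex} {z : Sym2 HexVertex}, p ∉ D → q ∈ D → hexGraph.Adj p q → q ∉ z → ∀ x : ℝ, (∑ γ : HexMidEdgeSAW D s(p, q) z, x ^ γ.length) = x * ∑ t ∈ (Literature.Barriers.CriticalPhenomena.HexGreen.nbrs q).erase p, ∑ δ : HexMidEdgeSAW (D.erase q) s(q, t) z, x ^ δ.length := by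
  intro D p q z hp hq hpq hqz x
  classical
  -- split the left-hand side over the second vertex
  have hmaps : ∀ γ ∈ (Finset.univ : Finset (HexMidEdgeSAW D s(p, q) z)),
      γ.verts.tail.headD p ∈ (nbrs q).erase p := fun γ _ => headD_mem hp hqz γ
  rw [← Finset.sum_fiberwise_of_maps_to hmaps, Finset.mul_sum]
  refine Finset.sum_congr rfl fun t ht => ?_
  rw [Finset.mem_erase, mem_nbrs_iff] at ht
  obtain ⟨htp, hqt⟩ := ht
  rw [Finset.mul_sum]
  -- the fibre over `t` is in bijection with the walks of `D ∖ q` from `{q,t}`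
  refine Finset.sum_bij' (fun γ hγ => (exists_tail hp hqz γ (Finset.mem_filter.1 hγ).2).choose)
    (fun δ _ => (exists_glue hp hq hpq hqz hqt htp δ).choose) (fun _ _ => Finset.mem_univ _)
    (fun δ _ => ?_) (fun γ hγ => ?_) (fun δ _ => ?_) (fun γ hγ => ?_)
  · -- the glued walk has second vertex `t`
    have h1 := (exists_glue hp hq hpq hqz hqt htp δ).choose_spec
    obtain ⟨l, hl⟩ := exists_cons_of_erase hqz δ
    refine Finset.mem_filter.2 ⟨Finset.mem_univ _, ?_⟩
    rw [h1, List.tail_cons, hl, List.headD_cons]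
  · -- glue ∘ cut = id
    have h2 := (exists_tail hp hqz γ (Finset.mem_filter.1 hγ).2).choose_spec
    have h1 := (exists_glue hp hq hpq hqz hqt htp
      (exists_tail hp hqz γ (Finset.mem_filter.1 hγ).2).choose).choose_spec
    obtain ⟨t', l, hl, -, -, -⟩ := exists_cons_cons hp hqz γ
    apply HexMidEdgeSAW.ext
    rw [h1, h2, hl, List.tail_cons]
  · -- cut ∘ glue = id
    have h1 := (exists_glue hp hq hpq hqz hqt htp δ).choose_spec
    have key : ∀ h : (exists_glue hp hq hpq hqz hqt htp δ).choose.verts.tail.headD p = t,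
        (exists_tail hp hqz (exists_glue hp hq hpq hqz hqt htp δ).choose h).choose.verts =
          (exists_glue hp hq hpq hqz hqt htp δ).choose.verts.tail :=
      fun h => (exists_tail hp hqz _ h).choose_spec
    apply HexMidEdgeSAW.ext
    rw [key, h1, List.tail_cons]
    obtain ⟨l, hl⟩ := exists_cons_of_erase hqz δ
    rw [h1, List.tail_cons, hl, List.headD_cons]
  · -- the length drops by one
    have h2 := (exists_tail hp hqz γ (Finset.mem_filter.1 hγ).2).choose_spec
    obtain ⟨t', l, hl, -, -, -⟩ := exists_cons_cons hp hqz γ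
    rw [HexMidEdgeSAW.length, HexMidEdgeSAW.length, h2, hl]
    simp only [List.tail_cons, List.length_cons]
    ring

/-- **Immediate exit.** For a door `{p,q}` of `D` and a second door `{q,y}` at the same vertex
(`y ∉ D`, `y ≠ p`, `y ∼ q`), the only walk `{p,q} → {q,y}` is `[q]`, of mass `x`. -/
theorem sum_pow_length_exit : ∀ {D : Finset HexVertex} {p q y : HexVertex}, p ∉ D → q ∈ D → hexGraph.Adj p q → y ∉ D → y ≠ p → hexGraph.Adj q y → ∀ x : ℝ, (∑ γ : HexMidEdgeSAW D s(p, q) s(q, y), x ^ γ.length) = x := by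
  intro D p q y hp hq hpq hy hyp hqy x
  classical
  have hz : s(q, y) ≠ s(p, q) := by
    intro h
    have : y ∈ s(p, q) := h ▸ Sym2.mem_mk_right q y
    rcases Sym2.mem_iff.1 this with h' | h'
    · exact hyp h'
    · exact hqy.ne h'.symm
  -- every such walk is `[q]`
  have hverts : ∀ γ : HexMidEdgeSAW D s(p, q) s(q, y), γ.verts = [q] := by
    intro γ
    obtain ⟨l, hl⟩ := exists_cons hp hz γ
    rcases l with _ | ⟨t, l'⟩
    · exact hl
    · exfalso
      -- the walk continues in `D` and must end at a vertex of `{q,y}`: impossible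
      have hnd := γ.nodup
      rw [hl, List.nodup_cons] at hnd
      have hlast := γ.getLast_mem ((q :: t :: l').getLast (List.cons_ne_nil _ _))
        (by rw [hl]; exact List.getLast?_eq_some_getLast _)
      rw [List.getLast_cons (List.cons_ne_nil _ _)] at hlast
      have hmem : (t :: l').getLast (List.cons_ne_nil _ _) ∈ t :: l' := List.getLast_mem _
      rcases Sym2.mem_iff.1 hlast with h | h
      · exact hnd.1 (h ▸ hmem)
      · exact hy (h ▸ γ.subset _ (by rw [hl]; exact List.mem_cons_of_mem q hmem))
  -- the walk `[q]` itself
  let γ₀ : HexMidEdgeSAW D s(p, q) s(q, y) :=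
    { verts := [q]
      subset := by simp [hq]
      nodup := List.nodup_singleton q
      isChain := List.isChain_singleton q
      head_mem := by simp
      getLast_mem := by simp
      eq_of_nil := fun h => absurd h (List.cons_ne_nil _ _)
      edges_nodup := fun _ => by simpa using hz.symm
      fst_mem := ⟨(SimpleGraph.mem_edgeSet hexGraph).2 hpq, q, Sym2.mem_mk_right _ _, hq⟩ }
  have huniv : (Finset.univ : Finset (HexMidEdgeSAW D s(p, q) s(q, y))) = {γ₀} := by
    ext γ
    simp only [Finset.mem_univ, Finset.mem_singleton, true_iff]
    exact HexMidEdgeSAW.ext (by rw [hverts γ])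
  rw [huniv, Finset.sum_singleton]
  simp [HexMidEdgeSAW.length, γ₀]

end Summit.CriticalPhenomena.SAWScalingLimit.Theorems.SAWDevelopingMapNoFoldBound.Peel
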